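import Summits.PneNP.PneNP.Theses.ExpanderLinearGenerators
import Literature.Computability.MetaComplexity.LinearMapResolutionWidthProofs

/-!
# PneNP / ExpanderLinearGenerators — the resolution rung `ExpanderXorResWidth` (stmt-PneNP-11445)

Route `PneNP/ExpanderLinearGenerators`, support item stmt-PneNP-11445 (`ExpanderXorResWidth`,
Krajíček, *Proof Complexity* (CUP 2019), Lemma 13.4.5, typed with a REAL expansion scale `r ≥ 1`):
for `ℓ ≥ 1`, `r ≥ 1` and every system `E` of `m` linear equations over `𝔽₂` in `n` unknowns with
`ℓ`-sparse rows whose supports form an `(r, 3/4 · ℓ)`-boundary expander and which is unsolvable,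
every resolution refutation `π` of the XOR-CNF `sumEncoding 1 E` has `resWidth π ≥ r / 4`.

The proof is the row-level Ben-Sasson–Wigderson width argument already in the tree
(`Literature/Computability/MetaComplexity/LinearMapResolutionWidthProofs.lean`, which discharges
the named fact `Krajicek2019_lemma_13_4_5` for natural `r`); its invariant
`not_resDerivable_empty_of_rows` is stated for real `r ≥ 2`, `c > 0` and forbids a derivation of
the empty clause in width `< c r / 2`, so for `c = 3ℓ/4`, `ℓ ≥ 1` it gives
`resWidth π ≥ 3 ℓ r / 8 ≥ r / 4` directly at real `r ≥ 2`; for `1 ≤ r < 2` the bound `r/4 < 1/2`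
only needs `resWidth π ≥ 1`, i.e. that the empty clause is not an initial clause
(`empty_notMem_clauseSet_of_expander`, expansion at a single row). Sparsity and unsolvability are
not used (the latter only makes refutations exist).

References: J. Krajíček, *Proof Complexity*, Encyclopedia Math. Appl. 170, CUP 2019, §13.4,
Lemma 13.4.5 (p. 273) [KrajicekProofComplexity2019]; E. Ben-Sasson, A. Wigderson, *Short proofs
are narrow — resolution made simple*, J. ACM 48 (2001), §4.2, §5, Thm 6.5 [BenSassonWigderson2001].
-/

namespace Summit.PneNP.PneNP.Theorems

set_option linter.dupNamespace false

open Literature.Computability.MetaComplexity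

/-- **The resolution rung of route ExpanderLinearGenerators** (item stmt-PneNP-11445,
Krajíček 2019 Lemma 13.4.5 at a real expansion scale): for `ℓ ≥ 1`, real `r ≥ 1` and an
`ℓ`-sparse unsolvable system `E` over `𝔽₂` whose row supports form an `(r, 3/4 · ℓ)`-boundary
expander, every resolution refutation `π` of `sumEncoding 1 E` has `r / 4 ≤ resWidth π`.
Row-level Ben-Sasson–Wigderson: `3ℓr/8 ≤ resWidth π` for `r ≥ 2` (`not_resDerivable_empty_of_rows`),
and `1 ≤ resWidth π` for `1 ≤ r < 2` (the empty clause is not an axiom).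
[KrajicekProofComplexity2019, Lemma 13.4.5; BenSassonWigderson2001, Thm 6.5] -/
theorem expanderXorResWidth_proof :
    Summit.PneNP.PneNP.Theses.ExpanderLinearGenerators.ExpanderXorResWidth := by
  unfold Summit.PneNP.PneNP.Theses.ExpanderLinearGenerators.ExpanderXorResWidth
  intro ℓ r n m E hℓ hr _ hexp _ π hπ
  have hD := resDerivable_empty_of_isResRefutation hπ
  have h1 : (1 : ℝ) ≤ ℓ := by exact_mod_cast hℓ
  have hc : (0 : ℝ) < 3 / 4 * ℓ := by linarith
  rcases lt_or_ge r 2 with hr2 | hr2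
  · -- `1 ≤ r < 2`: it suffices that the refutation contains a non-empty clause
    have hW1 : 1 ≤ resWidth π := by
      by_contra h0
      have h0' : resWidth π = 0 := by omega
      rw [h0'] at hD
      exact empty_notMem_clauseSet_of_expander E hexp hc hr (empty_mem_of_resDerivable_zero hD)
    have hW1' : (1 : ℝ) ≤ resWidth π := by exact_mod_cast hW1
    linarith
  · -- `r ≥ 2`: the Ben-Sasson–Wigderson invariant gives `3ℓr/8 ≤ resWidth π`
    have hnot : ¬ ((resWidth π : ℝ) < 3 / 4 * ℓ * r / 2) := fun hlt =>
      not_resDerivable_empty_of_rows E hexp hc hr2 hlt hD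
    push Not at hnot
    have hr0 : (0 : ℝ) ≤ r := by linarith
    nlinarith

end Summit.PneNP.PneNP.Theorems
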